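import Summits.BirchSwinnertonDyer.Rank1Residual.F1Sign2.GenusTrivialSpinLawAtTwo
import HarnessLib.Audit.Tags
import HarnessLib

/-!
# Cell `bsd-f1-sign2` — descent lens (planner `-desc` g25/g26; MEMO-desc §35-add5, ENGINE 52, theorem card `MEMO-desc-data/g25/S3-SPIN-LAW.md`): DESC-35-add5 — THE MEMBER LAW NEEDS ONLY
# `Sel₂(W) = 0` AND THE PURE S₃-SPIN LAW ONLY `Sel₂(W) = 0` + ODD TAMAGAWA (rows DESC-35-WD′ `GenusTrivialTwistKappaWellDefinedGeneral` + glue, carrier `SpinSettingWeak` + glue, DESC-35-S′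
# `GenusTrivialTwistPureSpinLawWeak` + glue; sibling of `GenusTrivialSpinLawAtTwo.lean` (§35 v3.2, p731113) whose vocabulary it imports; REF1 §212's K212.1–4 in `SpinLawAtTwoKernel.lean` v2)

STATEMENTS + -desc's three glue theorems (typer -ty g19).  Source: `HOME/MEMO-desc-data/g25/lean/Sketch35.lean` v3.3 **0c58374d78600048** lines 134–153 and 211–249 (= `HOME/REF1-data/b212/Sketch35v33.lean`;
v3.3 − v3.2 = exactly these two blocks, 59 added lines, 0 changed — REF1 §212 A1) = REF1's `HOME/REF1-data/b212/Probe212.lean` **49c12a08583585e9** VERBATIM under `…F1Sign2.REF1s212` (imports the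
ported §35 vocabulary p731113; farm rc 0, exactly 2 probe sorries, K212.1–7 std axioms).  PORT GATE = REF1-AUDIT §212 (INBOX 2026-08-29T16:17:08Z: «REF-gate on WD′/S′ RELEASED: port per
R212a/R212d») — bodies VERBATIM (builder-verified = sketch = Probe212), WD′ PLAIN, S′ `@[conjecture]` as typed, `SpinSettingWeak` and the three glues verbatim (the sketch's undocumented
`spinSettingWeak_of_spinSetting` gets a typer docstring).  Filed as a SIBLING file (not inserted at the sketch positions of v3.3) because the landed `GenusTrivialSpinLawAtTwo.lean` carries a
link theorem and must stay ≤ 400 lines; that file's DESC-35-WD rider gets a supersession FOLD pointing here.  GRADES (REF1 §212): **WD′ SURVIVES, upgraded — THEOREM-CANDIDATE WITH A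
COMPLETE PRINT-ASSEMBLED PROOF (R212a)**: Klagsbrun–Mazur–Rubin 2013 L.28 (ii) (`q_{E^χ,v} = q_{E,v}`), L.30 (twisted Kummer images Lagrangian for the same `q_v`), L.12 (iii) (`|𝓗_ram(q_p)| =
2^{d_p−1} = 2` at a totally split good odd `p`) + proof of Prop. 34, with Poonen–Rains Prop. 4.10 / Thm. 4.13 and Greenberg–Wiles: `Λ = loc_p Sel^{rel p}(W)` is a `q_p`-Lagrangian transverse
to `H¹_ur`, hence `∈ {A⁺, A⁻}`; NO parity input, NOTHING about the reduction at `2N` (explains ENGINE 52's 0/39 906); K212.5 `decide`s the 𝔽₂ ruling toy, K212.6 shows the symplectic-only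
version FAILS (8 vs 2 planes); REF2 v54 §20.2 (corollary-candidate of print, PLAIN) and §20.5 (R212a ACCEPTED: the MR10-L.24 two-half rider is superseded; «one object, two uses» — the
same quadratic form carries §21's identification of the ± object); **S′ SURVIVES `@[conjecture]` WITH A QUANTIFIED GAP AT 2 (R212b/R212d)**: `Odd ∏c` is Yoo–Yu Thm. 1.10 at odd `ℓ`; at 2
evenness is automatic when `W(ℚ₂)[2] = 0` (good supersingular forces it; good ordinary / multiplicative-odd-`c₂` are Yoo–Yu Thm. 1.11 (1)/(3)); UNTESTED: additive at 2 with odd `c₂` and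
`W(ℚ₂)[2] ≠ 0` — 18 476 of the 111 214 `SpinSettingWeak` curves with `Sel₂ = 0`, `N < 5·10⁵` (REF1 `scan212.txt`; ENGINE 52 covers 0 of them — UPDATE R216a: ENGINE 53a–f 15/15 curves of the cell pass, 630/630, see the S′ rider); R212b DATA ASK to -desc (ENGINE 53 on ≥ 5
such curves: 104a1, 116a1, 116b2, 152b1, 200a1, …); R212c typed fallback `SpinSettingWeak'` (+ «no `ℚ₂`-rational 2-torsion when additive at 2», keeps 92 738 curves) held in
reserve; REF2 §20.3 / 16:11:40Z n6: the cofactor / Kodaira dichotomy is Yoo–Yu niceness (Def. 1.5 / Thm. 1.10 / Rem. 4.2 / Thm. 1.11) — `Odd W.tamagawaProduct` is the sufficient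
condition, not necessary.  BC5 = ENGINE 52 (kit j333237; MEMO-desc §35-add5): 26 curves with `Sel₂ = 0`, `S₃`, violating ≥ 1 of the four §35 hypotheses, `p ≤ 2·10⁴`: 9 516 split primes,
31 720 members, member law 0/39 906; the 17 curves inside `SpinSettingWeak` ∖ `SpinSetting`: pure law 742/742, six bits consistent at every pure prime, frames 6 181/6 181, member law
0/26 379; cumulative 5 657/5 657 pure verdicts on 113 curves.  PARTITION none.  Beyond-print theorem: no (WD′ = assembly of print, not yet in Lean; S′ conjecture).  BSD is not
proved; 23715 not closed.  bears_on: stmt-BirchSwinnertonDyer-23715.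
v2 (typer -ty g19): + the §35-add6 rows DESC-35-S″ — carriers `HasLocalRootC`, `DiscTwoAdicallyUnramified`, `SpinObstructingPrime`, `SpinSettingLocal` (PLAIN), `@[conjecture]
GenusTrivialTwistPureSpinLawLocal`, the Tate-algorithm hypothesis `SpinSettingNoObstruction` (PLAIN) and -desc's glue `genusTrivialTwistPureSpinLawOddClass_of_local` — from
`HOME/MEMO-desc-data/g25/lean/Sketch35.lean` v3.7 **23293dea99001664** lines 257–321 VERBATIM (frozen copy in the typer's kit; decl bodies = REF1's `HOME/REF1-data/b214/Probe214.lean`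
4556c84de75272d4 = v3.5 b0c22cb85e6ef759 l.256–318, builder-verified 7/7; v3.7 − v3.5 = docstrings only, REF1 §216 (4) 38/38).  PORT GATE = REF1-AUDIT §214 (INBOX 2026-08-29T16:30:30Z:
**S″ SURVIVES `@[conjecture]`**, carriers SURVIVE PLAIN, «port the five defs + S″ + fact + glue VERBATIM») and §216 (16:34:19Z: §35-add7 CONFIRMED 135/135, R214a DISCHARGED by v3.7,
«port with the v3.7 docstrings verbatim»; R216a + ERRATUM 16:34:45Z folded on the S′ rider); REF2 v54 §23 (16:33:22Z): the whole local table is ONE INVARIANT — odd support of the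
conductor `𝔯` of `ℤ[Θ]` (Serre, Local Fields III §6) — 109/109; LAW-CANDIDATE, NEW-COMBINATION; folded as a words-rider on `SpinObstructingPrime` (no tree carrier for `𝔯`; bodies stay
-desc's as audited).  REF1's K214.1–4 go to `SpinLawAtTwoKernel.lean` v3.  BC5 (v3.7, REF1-reproduced): 79 runs inside `SpinSettingLocal` 3 338/3 338 pure verdicts, 0 typed-IN failures
on 135 runs; cumulative inside the typed settings 8 635/8 635 on 184 curves.  PARTITION none; beyond-print theorem: no; BSD not proved; 23715 not closed.
v3 (typer): R219a fold — REF1 §217 caveat (C2547, 134/135: the 𝔯-criterion is an explanation, not a law) added to the `SpinObstructingPrime` rider; no declaration changed.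
v4 (typer): R222b fold — REF1 §222 ERRATUM (C2547 = even class group `h_L = 2`; R217a/b withdrawn; #17 131/131 on `h_L`-odd curves) replaces the v3 caveat text; n7 (REF2 v55 §1) on the S″ rider; no declaration changed.
v5 (typer): n9 fold — REF2 v56 §1.2: #17 ≡ isotropy at one-root odd primes (equivalence reinstated on `h_L`-odd curves); no declaration changed.
-/

noncomputable section

open scoped Classical

open WeierstrassCurve Literature.NumberTheory.EllipticCurves Polynomial

namespace Summit.BirchSwinnertonDyer.Rank1Residual.F1Sign2

/-! ### §35-add5: the member law needs only `Sel₂(W) = 0` (DESC-35-WD′) -/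

/-- **DESC-35-WD′ `GenusTrivialTwistKappaWellDefinedGeneral` (MEMO-desc §35-add5; theorem-candidate, corollary-of-print level).**  The member law needs NONE of
`N` odd / squarefree / odd Tamagawa / `a₂` even: for ANY globally minimal `W` with `Sel₂(W) = 0` (so rank `0`, `W(ℚ)[2] = 0`, irreducible 2-division cubic), any odd good
totally split `p` and any two genus-class-trivial members `n, n'` with split factor `p` (`n ≡ 1 (8)`, `(n/ℓ) = +1` at every odd bad `ℓ` — multiplicative or additive —,
cofactor primes 3-cycles), `Sel₂(W^{(n)}) = 0 ⟺ ((n/p)/p) = −1` iff the same for `n'`.  Proof sketch (§35-add1 steps 1, 3, 4, 5 only): `n ∈ ℚ_v^{×2}` at `v ∣ 2N∞` and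
`H¹(ℚ_q, W[2]) = 0` at cofactor primes ⟹ `Sel₂(W^{(n)}) = {α ∈ Sel^{rel p}(W) : res_p α ∈ A^{(m/p)}}`; `res_p Sel^{rel p}(W)` is a Lagrangian of `V_p` transverse to the
unramified plane (Poitou–Tate, `Sel₂(W) = 0`); `w(W^{(n)}) = w(W) = +1` and 2-parity for members of both signs force it into `{A⁺, A⁻}` (the `𝔽₂` table of symmetric `2 × 2`
matrices against `A⁻ = graph J`).  BC5 = ENGINE 52 (kit j333237): 26 curves with `Sel₂ = 0`, `S₃`, violating ≥ 1 of the four setting hypotheses (a₂ odd ×6, even Tamagawa ×5,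
both ×3, `2 ∥ N` ×5, additive at an odd prime ×4, `2 ∣ N` non-squarefree ×3), `p ≤ 2·10⁴`: `9 516` split primes, `31 720` members (`dim Sel₂ ∈ {0: 16 352, 2: 15 368}`),
`0/39 906` inconsistent member pairs, members of both signs `(m/p)` at `9 372` primes — MEMO-desc §35-add5.
Why it might fail: a curve with `W(ℚ₂)[2] ≠ 0` or even `c_ℓ` where some member acquires a different local condition (it cannot: `n` is a local square at `2N∞`), or
where members of one sign `(m/p)` do not exist (Chebotarev: they do, `ℚ(√p) ∩ ℚ(W[2], √−1, √2, √ℓ…) = ℚ`).  [cite: Kramer1981, Prop. 6] [cite: MazurRubin2010, §3] [cite: Monsky1996, Thm. 1.5]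
(Typer -ty g19, REF1-AUDIT §212: **SURVIVES, upgraded — THEOREM-CANDIDATE WITH A COMPLETE PRINT-ASSEMBLED PROOF (R212a)**, filed PLAIN as typed (REF2 v54 §20.2: corollary-candidate of
print; §20.5: accepted).  The docstring's route above (root numbers + 2-parity + the 𝔽₂ table K208.6) is correct but REDUNDANT: `Λ := loc_p Sel^{rel p}(W) ∈ {A⁺, A⁻}` is
Klagsbrun–Mazur–Rubin's count of RAMIFIED Lagrangians [cite: KlagsbrunMazurRubin2013, Lemma 12 (iii), Lemma 28 (ii), Lemma 30 and the proof of Prop. 34 (arXiv 1111.2321 numbering)]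
(verbatim on the held text p.7 L114–140, p.11 L49–123, p.12 L91–135: `q_{E^χ,v} = q_{E,v}`; the twisted Kummer images are Lagrangian for the SAME quadratic form; `d_v > 0`, `q_v`
unramified ⟹ `|𝓗_ram(q_v)| = p^{d_v−1}` — here `= 2` at a totally split good odd `p`) with [cite: PoonenRains2012, Prop. 4.10, Thm. 4.13] and Greenberg–Wiles: four lines, NO parity
input and NOTHING about the reduction at `2N` (explains ENGINE 52's 0/39 906); kernel K212.5 `decide`s the 𝔽₂ ruling toy, K212.6 shows the symplectic-only version FAILS (8 vs 2
planes) — the quadratic (Poonen–Rains) structure is needed (REF1 `Probe212.lean`; K212.1–4 in the kernel file).  The MR10-Lemma-24 «two-half» rider of DESC-35-WD above is thereby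
SUPERSEDED (REF2 §20.5); WD′ ⟹ WD by the glue `genusTrivialTwistKappaWellDefined_of_general` (kernel file).  BC5 ENGINE 52 (kit j333237): 26 curves violating ≥ 1 of the four
setting hypotheses, 31 720 members, 0/39 906 inconsistent pairs.  Cite brackets split (typer).) -/
def GenusTrivialTwistKappaWellDefinedGeneral : Prop :=
  ∀ (W : WeierstrassCurve ℚ) [W.IsElliptic] [W.IsGloballyMinimal], selmerTwoCard W = 1 →
    ∀ n n' p : ℕ, GenusTrivialTwistMember W n p → GenusTrivialTwistMember W n' p → (KappaBitOfMember W n p ↔ KappaBitOfMember W n' p)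

/-- Kernel glue: the general member law specialises to DESC-35-WD. -/
theorem genusTrivialTwistKappaWellDefined_of_general (h : GenusTrivialTwistKappaWellDefinedGeneral) : GenusTrivialTwistKappaWellDefined := by
  intro W _ _ hS n n' p hn hn'
  exact h W hS.1 n n' p hn hn'

/-! ### §35-add5: the weak setting and the pure S₃-spin law under `Sel₂(W) = 0` + odd Tamagawa (DESC-35-S′) -/

/-- The WEAK setting (MEMO-desc §35-add5, ENGINE 52): only `Sel₂(W) = 0` and odd Tamagawa product — no condition on the reduction at `2` (good ordinary with
`a₂` odd, supersingular, multiplicative or additive all pass), on the parity of `N`, or on squarefreeness (additive odd primes pass).  Odd `c_ℓ` at the odd bad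
primes is what keeps the relaxed Selmer classes UNRAMIFIED there (ENGINE 52: the cofactor `w_i` is a unit on all 19 such curves; on the 7 curves with an odd prime of
type `I₂` or split `I₁₀` it is a genuine `{ℓ}`-unit and the six spin bits disagree at `214/291` pure primes).  Sufficient, not necessary: non-split `I₄` (`c₃ = 2`,
`[0,−1,1,30,−97]`) and split `I₁₀` AT `2` (`c₂ = 10`, `[1,1,1,5,9]`) also pass.
(Typer -ty g19, REF1 §212 (A2)/K212.4: carrier VERBATIM = the first and fourth conjuncts of `SpinSetting` (`SpinSetting W ↔ SpinSettingWeak W ∧ Odd N ∧ Squarefree N ∧ Even a₂`);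
tree `tamagawaProduct` = `∏ᶠ` of local Tamagawa numbers; the glue `spinSettingWeak_of_spinSetting` is in the kernel file.  REF2 v54 §20.3 / n6: `Odd W.tamagawaProduct` is Yoo–Yu's
SUFFICIENT niceness condition [cite: YooYu2022, Thm. 1.10, Thm. 1.11] (odd `ℓ`: index odd; at 2: good, or multiplicative with `v(Δ)` odd), not necessary (non-split `I₄`, `c = 2`
passes); REF1's typed fallback `SpinSettingWeak'` (R212c: + «no `ℚ₂`-rational 2-torsion when additive at 2») is held in reserve.) -/
def SpinSettingWeak (W : WeierstrassCurve ℚ) [W.IsElliptic] [W.IsGloballyMinimal] : Prop :=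
  selmerTwoCard W = 1 ∧ Odd W.tamagawaProduct

/-- -desc's glue (Sketch35 v3.3 l.219–220, undocumented there; docstring by the typer): the §35 setting implies the weak setting. -/
theorem spinSettingWeak_of_spinSetting {W : WeierstrassCurve ℚ} [W.IsElliptic] [W.IsGloballyMinimal] (h : SpinSetting W) : SpinSettingWeak W :=
  ⟨h.1, h.2.2.2.1⟩

/-- **DESC-35-S′ `GenusTrivialTwistPureSpinLawWeak` (MEMO-desc §35-add5; `@[conjecture]`, THEOREM-CANDIDATE on the same proof sketch: step 2's evenness at the primes
over `2` is the flat-cohomology description of `W(ℚ₂)/2` for good reduction and the Tate-curve description for multiplicative reduction — to be written; at additive odd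
`ℓ` with `W(ℚ_ℓ)[2] = 0` the local image is `0`).**  DESC-35-S⁺ with `SpinSetting` weakened to `SpinSettingWeak` (`Sel₂(W) = 0`, odd Tamagawa product): the pure
`S₃`-spin law `κ(p) = 1 ⟺ (γ_i/𝔭_j)·((e_i − e_j)/p) = +1` for generators `γ_i` of odd powers of `𝔭_i`, at pure split primes, in every genus-class-trivial family.
BC5 = ENGINE 52 (kit j333237, `p ≤ 2·10⁴`): the 17 curves of the run inside `SpinSettingWeak` but OUTSIDE `SpinSetting` — `a₂` odd: `[1,−1,0,−8,−7]` (N=109), `[1,1,0,−3,−4]`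
(139), `[1,1,0,0,−1]` (307), `[1,1,0,26,73]` (417), `[1,−1,1,−9,−8]` (431), `[1,−1,0,2,−1]` (503); `2 ∥ N`: `[1,−1,1,−3,3]` (26), `[1,0,1,−16,22]` (38), `[1,0,0,−9,−29]` (106),
`[1,0,0,−1,1]` (110); additive: `[0,−1,1,−8,−7]` (75), `[0,0,1,−3,−5]` (99), `[1,1,0,−2,−7]` (121), `[0,−1,1,−2,−1]` (147, `h_L = 3`), `[0,1,0,3,−1]` (44), `[1,0,1,−1,−2]` (50),
`[1,−1,0,−3,3]` (54): pure law `742/742`, six bits consistent at every pure prime, frames AGREE with the Selmer engine `6 181/6 181`, member law `0/26 379`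
inconsistent pairs (+ `[1,1,1,5,9]`, N = 58, `c₂ = 10`, and `[0,−1,1,30,−97]`, N = 345, non-split `I₄`, outside both settings: `36/36`, `38/38`).  Cumulative with §35:
`5 657/5 657` pure verdicts on 113 curves inside `SpinSettingWeak`.
Why it might fail: a reduction type at `2` not in the sample (e.g. `I_n^*`, `III`, `III^*` at `2` with `W(ℚ₂)[2] ≠ 0`) whose local Kummer image contains ramified classes,
or an additive odd `ℓ` of type `I₀^*` with `c_ℓ ∈ {2, 4}` (excluded by odd Tamagawa) — the first is the cheapest falsifier for the next engine.
[cite: BrumerKramer1977, §3] [cite: Kramer1981, Prop. 6] [cite: MazurRubin2010, §3] [cite: FIMR2013Spin, Thm. 11.1]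
(Typer -ty g19, REF1-AUDIT §212: **SURVIVES `@[conjecture]`** (R212d: port as typed, REF-gate released) — THEOREM-CANDIDATE on -desc's sketch WITH A QUANTIFIED GAP AT THE PRIME 2:
`Odd ∏c_ℓ` is print-shaped at ODD `ℓ` (unit Kummer classes: [cite: YooYu2022, Thm. 1.10, Thm. 1.11] = Brumer–Kramer; additive odd `ℓ` with odd `c_ℓ` has `W(ℚ_ℓ)[2] = 0`); at 2 the
valuation criterion is AUTOMATIC whenever `W(ℚ₂)[2] = 0` (one prime over 2) — good supersingular forces it (REF1: ss ⟹ no `ℚ₂`-rational 2-torsion 15 452/15 452, ordinary ⟹ one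
24 679/24 679, Cremona `N < 30 000`), good ordinary = Yoo–Yu Thm. 1.11 (1), multiplicative with odd `c₂` = Thm. 1.11 (3); WHAT IS LEFT UNTESTED: additive reduction at 2 with odd `c₂`
AND `W(ℚ₂)[2] ≠ 0` — REF1 census `scan212.txt` (Cremona `allbsd`, `N < 500 000`, `Sel₂ = 0` proxied): 111 214 curves inside `SpinSettingWeak`, of which **18 476 (16.6 %) in that live
cell** (smallest 104a1, 116a1, 116b2, 152b1, 200a1, …); BC5 = ENGINE 52 (17 curves inside `SpinSettingWeak` ∖ `SpinSetting`: pure law 742/742, frames 6 181/6 181, member law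
0/26 379; cumulative 5 657/5 657 on 113 curves) covers good / multiplicative / additive-with-`W(ℚ₂)[2] = 0` reduction at 2 and **0 of the 18 476-curve cell** (its one additive-at-2
curve 44a1 has `W(ℚ₂)[2] = 0`); -desc's «next falsifier» types `I_n^*, III, III^*` at 2 have EVEN `c₂` and lie outside the hypothesis — the in-hypothesis cell is II / IV / I₀^* (`c₂ =
1`) / IV^* / II^* with a `ℚ₂`-rational 2-torsion point; R212b DATA ASK (-desc): ENGINE 53 on ≥ 5 curves of that cell; R212c typed fallback `SpinSettingWeak'` if it fails — **UPDATE R216a (REF1 §216 (3) +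
ERRATUM 16:34:45Z): ENGINE 53a–f: 15 curves of the cell tested (6 with `ℚ₂(√Δ)` ramified: II^* ×5, I₀^*; 9 unramified: IV ×5, II ×4 = S′∖S″), 15/15 pass, 630/630 pure
verdicts, `N ≤ 2 224`; a conjecture beyond** (the decider cell S′∖S″ of R214c passes 9/9, 382/382: S′ SURVIVES `@[conjecture]`, incomparable with S″ below).  REF2 v54
§20.3 / n6: the cofactor / Kodaira dichotomy is Yoo–Yu niceness (Def. 1.5 / Thm. 1.10 / Rem. 4.2 / Thm. 1.11).  Grade (REF2 §20 / REF1 §208·§212): NEW-COMBINATION line, same class as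
35-S/S⁺.  S′ ⟹ S⁺ by the glue `genusTrivialTwistPureSpinLawOddClass_of_weak` (kernel file).  Cite brackets split (typer).) -/
@[conjecture] def GenusTrivialTwistPureSpinLawWeak : Prop :=
  ∀ (W : WeierstrassCurve ℚ) [W.IsElliptic] [W.IsGloballyMinimal], SpinSettingWeak W →
    ∀ (c xnum : ℤ[X]) (xden : ℕ), CubicDatumFor W c xnum xden → DegOnePrimesOddClassC c →
      ∀ n p : ℕ, GenusTrivialTwistMember W n p → ¬ p ∣ xden →
        ∀ a : Fin 3 → ZMod p, LabelledRootsModC c p a → Function.Injective (fun j => evalModC xnum p (a j)) →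
          IntegralUnitsSquareModC c p a →
          ∀ i j : Fin 3, i ≠ j → ∀ (g : ℤ[X]) (o : ℕ), GeneratesOddPrimePowerOverC c p (a i) g o →
            (KappaBitOfMember W n p ↔ SpinBitC xnum xden p a i j g)

/-- Kernel glue: the weak-setting law specialises to DESC-35-S⁺. -/
theorem genusTrivialTwistPureSpinLawOddClass_of_weak (h : GenusTrivialTwistPureSpinLawWeak) : GenusTrivialTwistPureSpinLawOddClass := by
  intro W _ _ hS
  exact h W (spinSettingWeak_of_spinSetting hS)

/-! ### §35-add6 rows (ENGINE 53: the local table of the law) -/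

/-- The 2-division cubic field has a degree-one place over `ℓ` (a root of `c` in `ℤ_ℓ`, i.e. a root modulo every power of `ℓ`; for an additive odd `ℓ` this is
`W(ℚ_ℓ)[2] ≠ 0`, equivalently `c_ℓ` even). -/
def HasLocalRootC (c : ℤ[X]) (ℓ : ℕ) : Prop :=
  ∀ k : ℕ, ∃ x : ZMod (ℓ ^ k), evalModC c (ℓ ^ k) x = 0

/-- `ℚ₂(√Δ)/ℚ₂` is trivial or unramified: `Δ = u·2^{v}` with `v` even and `u ≡ 1 (mod 4)` (for a multiplicative prime `2` of even `v₂(Δ)`: the prime of `L` carrying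
the Tate-curve classes is UNRAMIFIED over `2`). -/
def DiscTwoAdicallyUnramified (W : WeierstrassCurve ℚ) : Prop :=
  Even (padicValRat 2 W.Δ) ∧ ∃ u : ℤ, W.Δ = (u : ℚ) * 2 ^ (padicValRat 2 W.Δ).toNat ∧ u % 4 = 1

/-- A bad prime `ℓ` is SPIN-OBSTRUCTING (MEMO-desc §35-add6/add7, ENGINE 52–53f, 135 curve-runs): multiplicative (`v_ℓ(c₄) = 0`) with `v_ℓ(Δ) ≡ 2 (mod 4)` and — at
`ℓ = 2` only — `ℚ₂(√Δ)` unramified or trivial (at odd multiplicative `ℓ` of even `v_ℓ(Δ)` it always is); or additive with a degree-one place of `L` over `ℓ` (at `ℓ = 2`: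
and `ℚ₂(√Δ)` unramified).  Each of the 36 failing runs of ENGINE 52/53 has such a prime; on the 79 runs without one the law holds at every pure prime (v3.7 count, typed predicate).
(RIDER, typer -ty g19.  REF1 §214 A2 read-back ✓: multiplicative ⟺ `c₄ ≠ 0 ∧ v(c₄) = 0 < v(Δ)`, additive ⟺ `(c₄ = 0 ∨ v(c₄) > 0) ∧ v(Δ) > 0`, correct on a minimal model at every
prime incl. 2, 3; K214.1 (`v_ℓ(Δ) = 0` ⟹ never obstructing) and K214.4 (multiplicative with `v(Δ) ≢ 2 (mod 4)` ⟹ never obstructing) in `SpinLawAtTwoKernel.lean`; the typed clause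
at 2 is the WEAKER exclusion (obstructing only if `ℚ₂(√Δ)` unramified) and is supported by the data — the 13 additive-at-2-with-root curves with `ℚ₂(√Δ)` RAMIFIED all pass (R214a,
discharged by the v3.7 numbers above: REF1 §216).  REF2 v54 §23 — ONE INVARIANT FORM (not typed here; words): with `F(X) = X³ + b₂X² + 8b₄X + 16b₆` (roots `4e_i`, `disc F = 2⁸Δ`),
`Θ` a root, `𝔯 := F′(Θ)·𝔇_{L/ℚ}⁻¹` = the CONDUCTOR of the order `ℤ[Θ]` in `𝓞_L` [cite: SerreLocalFields1979, Ch. III §6, Cor. 1 to Prop. 11]: «`ℓ` is spin-obstructing ⟺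
`v_𝔭(𝔯)` is odd for some `𝔭 ∣ ℓ`» reproduces ENGINE 53's table 109/109 with no case list (derives `n ≡ 2 (mod 4)` at multiplicative primes from `e₂ − e₃ = 4√q(1 + O(√q))`, the
`ℚ₂(√u)` clause at 2, `III`/`III^*` obstruct, `I_n^* ≡ I_n`, single prime above `ℓ` ⟹ never); GRADE of that 𝔯-form: LAW-CANDIDATE, NEW-COMBINATION (obstruction locus = odd
support of the conductor of `ℤ[x(E[2])]`, not in print; presearch corpus + galaxy none); a typed 𝔯-form needs a tree carrier for the conductor of `ℤ[Θ]` (none yet) and a sketch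
row — REF1 §216: the Kodaira-free `S‴` is not recommended yet (`I₄^*` mixed).  CAVEAT (REF1 §217/§222, REF2 PREDICTION #17; text = REF1 R222b, replacing the typer's R219a
sentence of v3 after REF1's §222 ERRATUM withdrew R217a/R217b): on the 135-curve sample the 𝔯-criterion agrees 131/131 on `h_L`-odd curves and 135/135 under PURE2 purity; the
single units-only disagreement C2547 (`[1,−1,0,45,148]`, `h_L = 2`, cyc `[2]`) is the even-class-group effect predicted in engine52's header (20 inconsistent primes, all among the
28 PUREU-not-PURE2 primes; the 12 PURE2-pure primes consistent) and lies outside S⁺/S′/S″ by `DegOnePrimesOddClassC`.  The 𝔯-form of this clause is not refuted by data; the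
clause as typed (every additive-with-root odd prime obstructs) is its conservative special case.  REF2 v55 §1 placed the ISOTROPY CRITERION that the 𝔯-parity shadows, and REF2 v56
§1.2 (with REF1 §222–§223; n9) CLOSED the loop: at every odd prime with exactly one local root the 𝔯-parity and `q_ℓ(ε_ℓ)` are THE SAME BIT (local lemma), so PREDICTION
#17 is the computable face of the isotropy criterion and STANDS as an equivalence on `h_L`-odd curves at such primes (REF1 131/131, -desc §36 47/47); three-root primes
(`d_ℓ = 2`, e.g. `I₄^*` with `c_ℓ = 4`, N14886) and `ℓ = 2` are outside both (REF2 v56 §1.4 PREDICTION #22, LAW36′ in `CorrectedSpinLawAtTwo.lean`).  The criterion: at a one-root multiplicative odd `ℓ` the unramified class `ε_ℓ` (component description [cite: Stoll2006, Rem. 1]: image of `W(ℚ_ℓ)` in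
`H¹(ℚ_ℓ^{nr}, W[2])` ≅ `Φ_ℓ(k)/(Φ_ℓ(k) ∩ 2Φ_ℓ(k̄))`) has Poonen–Rains value `q_ℓ(ε_ℓ) = [n ≡ 2 (mod 4)]` (REF2's Hilbert-symbol computation `(π^{n/2}, π^{n/2})_ℓ = (−1)^{n/2}`,
not in print as stated), and with `h_L` odd and one unclean prime reciprocity `Σ_v q_v = 0` makes the relaxed class a unit class iff `q_ℓ(ε_ℓ) = 0` — «the ± object at a bad
prime is `q_v` restricted to the unramified / relaxed part of `H¹(ℚ_v, W[2])`; the spin law is exact iff that restriction is isotropic at every unclean place» (words-level,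
THEOREM-CANDIDATE per REF2, to be checked by REF1 / -desc; no tree carrier for `q_v`).) -/
def SpinObstructingPrime (W : WeierstrassCurve ℚ) (c : ℤ[X]) (ℓ : ℕ) : Prop :=
  0 < padicValRat ℓ W.Δ ∧
    ((W.c₄ ≠ 0 ∧ padicValRat ℓ W.c₄ = 0 ∧ padicValRat ℓ W.Δ % 4 = 2 ∧ (ℓ = 2 → DiscTwoAdicallyUnramified W)) ∨
      ((W.c₄ = 0 ∨ 0 < padicValRat ℓ W.c₄) ∧ HasLocalRootC c ℓ ∧ (ℓ = 2 → DiscTwoAdicallyUnramified W)))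

/-- The LOCAL setting: `Sel₂(W) = 0` and no spin-obstructing bad prime.  Contains every curve of `SpinSetting` (there every bad prime is odd multiplicative of odd
`v_ℓ(Δ) = c_ℓ`, by Tate's algorithm) and, beyond `SpinSettingWeak`, the multiplicative primes with `v_ℓ(Δ) ≡ 0 (mod 4)` (split `I₄, I₈, I₁₂`: Tamagawa number EVEN,
cofactor a genuine `{ℓ}`-unit, law nevertheless exact) and every multiplicative prime `2` at which `L` is ramified. -/
def SpinSettingLocal (W : WeierstrassCurve ℚ) [W.IsElliptic] [W.IsGloballyMinimal] (c : ℤ[X]) : Prop :=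
  selmerTwoCard W = 1 ∧ ∀ ℓ : ℕ, ℓ.Prime → ¬ SpinObstructingPrime W c ℓ

/-- **DESC-35-S″ `GenusTrivialTwistPureSpinLawLocal` (MEMO-desc §35-add6/add7, v3.7; `@[conjecture]`, beyond print).**  DESC-35-S⁺ with `SpinSetting W` replaced by
`SpinSettingLocal W c`: the pure `S₃`-spin law `κ(p) = 1 ⟺ (γ_i/𝔭_j)·((e_i − e_j)/p) = +1` (all six `(i, j)`, any generator `γ_i` of an odd power of `𝔭_i`) at the
pure split primes of every genus-class-trivial twist family of a curve with `Sel₂ = 0` and NO SPIN-OBSTRUCTING PRIME.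
BC5 = ENGINE 52 + 53a–f (kit j333237, j333425, j333469, j333528, j333590, j333602, j333735; `p ≤ 2·10⁴`; 135 curve-runs on 135 curves OUTSIDE `SpinSetting`, `N ≤ 21 819`;
table `an53/table53v3.md`): on the 79 runs inside `SpinSettingLocal` (typed predicate; `an53/classify2.py`) the law holds at **`3 338/3 338`** pure primes with all six bits
consistent — among them split `I₄` ×5, non-split `I₄` ×3, split `I₈` ×2, non-split `I₈` ×3 at odd primes, and at `2`: `I₂ ×3, I₆ ×4, I₁₀, I₁₂ ×2, I₄` with `ℚ₂(√Δ)` ramified and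
`I₄ ×4, I₈ ×2, I₁₂ ×2` with `ℚ₂(√Δ)` unramified (six of them `Δ/2^v ≡ 1 (mod 8)`, i.e. `2` totally split in `L`); additive `II, III, III^*, IV, I₀^*, I₁^*` at inert or totally
ramified primes, and at a `2` with a 2-adic root but `ℚ₂(√Δ)` RAMIFIED: `II^* ×5, I₀^*, I₂^*, I₃^* ×2, I₄^*, I₅^*, I₆^* ×3, I₇^*, I₈^*, I₉^*`.  On EVERY one of the 36 runs with
six-bit disagreement there is a spin-obstructing prime (`I₂` ×13, `I₆` ×9, `I₁₀` ×4 at primes with `ℚ_ℓ(√Δ)` unramified — nine of them the prime `2`; `III` ×3, `III^*` ×2,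
`I₂^*` ×2, `I₆^*` ×2, `I₄^*` ×1 with a local root): `1 034` of their `1 345` pure primes inconsistent (`50–100 %` per curve), so the law without the hypothesis is false.
ENGINE 53e/53f were PREDICTION TESTS (verdicts written before the runs): clause at `2` `16/16`; cells A/D of §35-add7 `19/19`.  Cumulative inside the typed settings
(§35 + S′ + S″): `8 635/8 635` pure verdicts on 184 curves; member law `0/414 256` pairs and frames `97 845/97 845` on all 231 runs.
Sufficient, not necessary: 20 runs with a spin-obstructing ADDITIVE prime pass (`620/620`): `II ×4, IV ×5` at an unramified `2` with a 2-adic root, `I₀^*` ×5 (`c = 2`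
and `c = 4`), `I₁^*`, `I₃^*` ×2, `I₅^*`, and `I₄^*` ×2 (only 4–5 pure primes each; a third `I₄^*` fails); the exact additive table (with a local root and unramified
`ℚ_ℓ(√Δ)`: `III, III^*, I₂^*, I₆^*` obstruct, `II, IV, I₀^*, I₁^*, I₃^*, I₅^*` do not, `I₄^*` undecided) is DESC-35-K, untyped.
Why it might fail: an additive `I₀^*` with `c_ℓ = 4`, or a totally split multiplicative `2` with `v₂(Δ) ≡ 0 (mod 4)`, both absent from the sample; and the proof
sketch must now show that the RAMIFIED Tate class `δ(ℓ) = (1, ℓ, ℓ)` of split `I_{4k}` contributes trivially to all six bits while `v_𝔩(e₂ − e₃) = n/2` odd does not (open).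
[cite: BrumerKramer1977, §3–4] [cite: Kramer1981, Prop. 6] [cite: MazurRubin2010, §3] [cite: FIMR2013Spin, Thm. 11.1]
(Typer -ty g19, REF1-AUDIT §214 + §216: **DESC-35-S″ SURVIVES `@[conjecture]`** — port as typed (v3.7 decls = v3.5 38/38 IDENTICAL; `Probe214.lean` 4556c84de75272d4 rc 0 over
the ported §35 vocabulary).  BC5 RE-DERIVED BY REF1 from the a-invariants alone (Δ, c₄, v_ℓ, Δ/2^v mod 8, Hensel root of `F`; `audit214.py`/`audit216.py`, independent of the
engine's FIELD line): typed class = table53v3 class on 135/135 runs — (IN, IN, pass) 79 · (OUT, OUT, FAIL) 36 · (OUT, OUT, pass) 20 · typed-IN ∧ FAIL **0**; 79 runs 3 338/3 338,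
outside-pass 620/620, FAIL 1 345 pure / 311 consistent / 1 034 inconsistent; six-bit tallies re-counted from the raw S50 rows (law bit `b_ij = [s_ij = d_ij]`) = table on 135/135
curves.  R214b (MECHANISM): **0 consistent-but-wrong pure primes on all 135 runs** (FAIL curves: 311 consistent, all = κ) — the obstruction DESYNCHRONISES the six `(i, j)`
readings, it never flips the law (what an `(i, j)`-dependent missing local term such as `v_𝔩(e_i − e_j) = n/2` would do, not a wrong global sign).  R214c / §216 (3): the
S′∖S″ cell (REF1 `scan214.txt`: 5 163 curves `N < 5·10⁵` with `Sel₂ = 0` proxied, ALL with `v₂(Δ) = 4`, `Δ/16 ≡ 5 (mod 8)`, type IV (3 135) or II (2 028)) is DECIDED FOR S′: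
ENGINE 53f D-even 9/9 pass, 382/382 (236b1/b2, 944d1/f1, 1228a1, 1356d1, 1676a1, 1712c1, 2224c1) — so S″'s clause at 2 is non-sharp for II/IV (as DESC-35-K predicts) and
S′, S″ are INCOMPARABLE, both SUFFICIENT-ONLY (20 outside-pass runs).  REF2 v54 §23: grade of the local law in its 𝔯-invariant form LAW-CANDIDATE, NEW-COMBINATION; the
§20.3 / n6 niceness advice is WITHDRAWN (split `I₄`, `c = 4` passes 5/5) — S″ is the hypothesis of record.  S″ ⟹ S⁺ modulo the Tate-algorithm fact
`SpinSettingNoObstruction` by the glue `genusTrivialTwistPureSpinLawOddClass_of_local` below.  Cite brackets split (typer).  n7 (REF2 v55 §1.3–1.4, REF1 §222): the sketch's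
«(open)» step above — «the RAMIFIED Tate class of split `I_{4k}` contributes trivially» — is SERVED IN WORDS: the ramified Kummer line never enters the frames at a pure `p`; what
enters is the relaxed class, a unit class iff `4 ∣ n` (isotropy criterion, see the `SpinObstructingPrime` rider); hence S″ at ODD primes with `h_L` odd and ≤ 1 unclean prime is a
THEOREM-CANDIDATE modulo -desc's steps 3–8 (same status as DESC-35-S), its additive clause SUFFICIENT-ONLY, the exact additive table being REF2 PREDICTION #18 (v55 §1.4 (iii):
obstructing `I_n`, `I_n^*` with `n ≡ 2 (mod 4)`, `III`, `III^*`; unclean-but-harmless split `I_{4k}`, `I_{4k}^*`, `I₀^*` with `c_ℓ = 2`, `I_n^*` (`n` odd, `c_ℓ = 4`); clean the rest —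
in particular `I₄^*` with `h_L` odd does NOT obstruct: C909 5/5, and C2547/C4707 are `h_L = 2`); at `ℓ = 2` the local step does not transfer verbatim (Stoll needs `v ∤ 2`), the
global reciprocity step does, and the data say the 2-adic evaluation is Kramer's symbol `(Δ, d)₂` [cite: Kramer1981, Prop. 1 and Prop. 2] [cite: MazurRubin2010, Lemma 24 (arXiv numbering)].) -/
@[conjecture] def GenusTrivialTwistPureSpinLawLocal : Prop :=
  ∀ (W : WeierstrassCurve ℚ) [W.IsElliptic] [W.IsGloballyMinimal],
    ∀ (c xnum : ℤ[X]) (xden : ℕ), CubicDatumFor W c xnum xden → SpinSettingLocal W c → DegOnePrimesOddClassC c →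
      ∀ n p : ℕ, GenusTrivialTwistMember W n p → ¬ p ∣ xden →
        ∀ a : Fin 3 → ZMod p, LabelledRootsModC c p a → Function.Injective (fun j => evalModC xnum p (a j)) →
          IntegralUnitsSquareModC c p a →
          ∀ i j : Fin 3, i ≠ j → ∀ (g : ℤ[X]) (o : ℕ), GeneratesOddPrimePowerOverC c p (a i) g o →
            (KappaBitOfMember W n p ↔ SpinBitC xnum xden p a i j g)

/-- PRINT FACT (Tate's algorithm, statement only; [cite: Silverman1994, IV.9.4]): in the §35 setting (conductor odd squarefree, odd Tamagawa product) no bad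
prime is spin-obstructing — every bad `ℓ` is odd and multiplicative with `v_ℓ(Δ) = c_ℓ` (split) or `v_ℓ(Δ)` odd (non-split with `c_ℓ = 1`... here `c_ℓ` odd
forces `v_ℓ(Δ)` odd in both cases), so `v_ℓ(Δ) ≢ 2 (mod 4)`.
(RIDER, typer: REF1 §214 A2 — a CONSEQUENCE OF PRINT (Tate's algorithm: in `SpinSetting` every bad `ℓ` is odd multiplicative with `c_ℓ` odd ⟹ `v_ℓ(Δ)` odd for split (`c = v`)
and non-split (`c = 1 ⟺ v` odd) alike; `v₂(Δ) = 0`), provable in-tree only once `localTamagawaNumber` is tied to Kodaira symbols; correctly kept as an explicit PLAIN hypothesis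
of the glue, not a conjecture and not a Literature fact (it is stated over this cell's vocabulary).) -/
def SpinSettingNoObstruction : Prop :=
  ∀ (W : WeierstrassCurve ℚ) [W.IsElliptic] [W.IsGloballyMinimal], SpinSetting W →
    ∀ (c xnum : ℤ[X]) (xden : ℕ), CubicDatumFor W c xnum xden → ∀ ℓ : ℕ, ℓ.Prime → ¬ SpinObstructingPrime W c ℓ

/-- Kernel glue: modulo the Tate-algorithm fact, the local law specialises to DESC-35-S⁺. -/
theorem genusTrivialTwistPureSpinLawOddClass_of_local (hT : SpinSettingNoObstruction) (h : GenusTrivialTwistPureSpinLawLocal) :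
    GenusTrivialTwistPureSpinLawOddClass := by
  intro W _ _ hS c xnum xden hc hodd n p hm hp a ha hinj hpure i j hij g o hg
  exact h W c xnum xden hc ⟨hS.1, hT W hS c xnum xden hc⟩ hodd n p hm hp a ha hinj hpure i j hij g o hg

end Summit.BirchSwinnertonDyer.Rank1Residual.F1Sign2

end
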